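import Literature.Probability.RandomPlanarGeometry.RestrictionMeasuresProofs
import Literature.Probability.RandomPlanarGeometry.StarHullExtension
import HarnessLib

/-!
# A zero–one law for two-sided restriction measures: conformally invariant events are trivial

Proof-only file (no definition, no named fact), after

* G. F. Lawler, O. Schramm, W. Werner, *Conformal restriction: the chordal case*, J. Amer. Math.
  Soc. **16** (2003) 917–955, arXiv:math/0209343 (**[LSW]**), §3: Def. 3.1 (p. 10, the space
  `Ω`), "for all `A ∈ 𝒜`, the law of `Φ_A(K)` conditional on `{K ∩ A = ∅}` is equal to `P`"
  (the restriction property, p. 10), Prop. 3.3 (p. 10: a probability measure on `Ω` is the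
  restriction measure `P_α` iff `P[K ∩ A = ∅] = Φ'_A(0)^α` for all `A ∈ 𝒬*`; proof, p. 11:
  "Define the homomorphism `F` of `𝒬*` […] `F(A · A') = F(A) F(A')`"), §2 p. 8 (the semigroup
  `𝒬*`: "`A · A'` is defined by `Φ_{A·A'} = Φ_A ∘ Φ_{A'}`"), Lemma 3.2 (p. 10, the avoidance
  events characterize a probability measure; §3 p. 10: "this family of events is closed under
  finite intersection").

The tree defines `P_α` by the avoidance formula of Prop. 3.3 (3) (`IsRestrictionMeasure`,
`RestrictionMeasures`) and has the semigroup `𝒬*` with the chain rule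
`Φ'_{A·A'}(0) = Φ'_A(0) Φ'_{A'}(0)` (`RestrictionSemigroup`) and the π-system / Dynkin lemma
(`RestrictionConfig.isPiSystem_avoid_holds`, `RestrictionMeasuresProofs`); the image map
`K ↦ Φ_A(K)` on `Ω` was "not vendored" (`RestrictionMeasures`, module docstring). This file
PROVES:

* `RestrictionConfig.image_mem_restrictionConfigs` — **for `K ∈ Ω` avoiding `A ∈ 𝒬*` and a
  restriction map `Φ_A`, the image `Φ_A(K)` is again an element of `Ω`** (Def. 3.1: relatively
  closed, connected, `cl ∩ ℝ = {0}`, unbounded — from the tree's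
  `IsRestrictionMap.closure_image_subset` / `not_isBounded_image` — and `ℂ ∖ cl Φ_A(K)`
  connected: every point `Φ_A(z)` of `ℍ ∖ Φ_A(K)` is joined to the lower half-plane off
  `cl Φ_A(K)`, because a path from `z` to `−i` off `cl K` run until it first leaves `ℍ ∖ A`
  is mapped to a connected set accumulating at a NONZERO REAL point — `Φ_A` is proper
  (`IsRestrictionMap.tendsto_symm_cocompact`) and `Φ_A⁻¹ → 0` only at `0`
  (`IsRestrictionMap.tendsto_symm_nhdsWithin_zero`, by the open mapping theorem for the
  Schwarz reflection `hullExt Φ` at `0`, `E'(0) = Φ'_A(0) > 0`));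
* `IsRestrictionMeasure.measure_avoid_hullProduct` — `P_α[K ∩ (B · A) = ∅] = P_α[K ∩ A = ∅] ·
  P_α[K ∩ B = ∅]` (Prop. 3.3 proof: `F` is a homomorphism), and
  `IsRestrictionMeasure.measure_avoid_inter_preimage_eq` — **the restriction property**: for
  every measurable `F ⊆ Ω`, `P_α[K ∩ A = ∅, Φ_A(K) ∈ F] = P_α[K ∩ A = ∅] · P_α(F)` (the two
  finite measures agree on the avoidance events by the homomorphism identity, hence on the
  generated σ-field — Lemma 3.2);
* `IsRestrictionMeasure.measure_eq_zero_or_one_of_invariant` — **ZERO–ONE LAW**: a measurable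
  event `E ⊆ Ω` which is invariant under every `Φ_A` (`K ∈ E ⟺ Φ_A(K) ∈ E` whenever
  `K ∩ A = ∅`, `A ∈ 𝒬*`) has `P_α(E) ∈ {0, 1}`: by the restriction property and invariance
  `P_α(E ∩ {K ∩ A = ∅}) = P_α(E) P_α[K ∩ A = ∅]` for all `A ∈ 𝒬*`, so the finite measures
  `P_α(· ∩ E)` and `P_α(E) P_α` agree (Lemma 3.2 again), and at `E`: `P_α(E) = P_α(E)²`;
* `IsRestrictionMeasure.measure_interior_nonempty_eq_zero_or_one`,
  `IsRestrictionMeasure.ae_interior_nonempty_of_measure_ne_zero` — the event "`K` has an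
  interior point" is invariant (`Φ_A` is a homeomorphism of `ℍ ∖ A` onto `ℍ`), hence trivial;
  so `P_α{int K ≠ ∅} > 0` already gives `P_α`-a.s. `int K ≠ ∅` (used by the sibling file
  `RestrictionMeasuresFiveEighthsInteriorHolds` to close [LSW]'s "for `α > 5/8`, `P_α` is not
  supported on simple curves" in its almost sure interior form).

The zero–one law is not stated in [LSW]; it is the measure-theoretic content of their
restriction property combined with Lemma 3.2, and every step is proved here.

Mathlib: `MeasureTheory.ext_of_generate_finite`, `measurable_generateFrom`,
`AnalyticAt.eventually_constant_or_nhds_le_map_nhds`,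
`IsPathConnected.joinedIn`, `Path.extend`, `IsClosed.csInf_mem`, `isPreconnected_of_forall`,
`IsCompact.tendsto_subseq`, `ConformalEquiv.isOpen_image` (tree, `HullThickening`),
`ENNReal.mul_right_inj`. Tree: `hullProduct`, `IsStarHull.hullProduct`,
`IsRestrictionMap.hullProduct`, `HasRestrictionDeriv.hullProduct`,
`RestrictionConfig.mem_avoid_hullProduct_iff`, `RestrictionConfig.isPiSystem_avoid_holds`,
`IsRestrictionMap.closure_image_subset`, `IsRestrictionMap.not_isBounded_image`,
`IsRestrictionMap.tendsto_symm_cocompact`, `hullExt` and its API (`StarHullExtension`),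
`IsStarHull.exists_isRestrictionMap`, `IsStarHull.exists_hasRestrictionDeriv_holds`,
`RestrictionConfig.measurableSet_interior_nonempty`.

## References

* [LSW] Def. 3.1, §3 p. 10 (restriction property; the events `{K ∩ A = ∅}`), Lemma 3.2,
  Prop. 3.3 and its proof (pp. 10–11), §2 p. 8 (semigroups). [LawlerSchrammWerner2003Restriction]
-/

noncomputable section

open Set Filter Topology Metric Bornology Complex MeasureTheory
open UpperHalfPlane (upperHalfPlaneSet isOpen_upperHalfPlaneSet)
open scoped NNReal ENNReal ComplexConjugate

namespace Literature.Probability.RandomPlanarGeometry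

/-! ### Conformal equivalences preserve interior points -/

namespace ConformalEquiv

variable {U V : Set ℂ}

/-- **Interior points are preserved**: for `K ⊆ U` (both `U`, `V` open), `Φ(K)` has an interior
point iff `K` has one (`ConformalEquiv.isOpen_image` for `Φ` and `Φ⁻¹`). [folklore] -/
theorem interior_image_nonempty_iff (Φ : ConformalEquiv U V) (hU : IsOpen U) (hV : IsOpen V)
    {K : Set ℂ} (hK : K ⊆ U) : (interior (Φ '' K)).Nonempty ↔ (interior K).Nonempty := by
  constructor
  · rintro ⟨w, hw⟩
    have hKV : Φ '' K ⊆ V := by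
      rintro _ ⟨z, hz, rfl⟩
      exact Φ.mapsTo (hK hz)
    have hWsub : interior (Φ '' K) ⊆ V := interior_subset.trans hKV
    have hopen : IsOpen (Φ.symm '' interior (Φ '' K)) := Φ.symm.isOpen_image hU isOpen_interior hWsub
    have hsub : Φ.symm '' interior (Φ '' K) ⊆ K := by
      rintro _ ⟨v, hv, rfl⟩
      obtain ⟨z, hz, rfl⟩ := interior_subset hv
      rw [Φ.symm_apply_apply (hK hz)]
      exact hz
    exact ⟨Φ.symm w, interior_maximal hsub hopen ⟨w, hw, rfl⟩⟩
  · rintro ⟨z, hz⟩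
    have hopen : IsOpen (Φ '' interior K) := Φ.isOpen_image hV isOpen_interior (interior_subset.trans hK)
    exact ⟨Φ z, interior_maximal (image_mono interior_subset) hopen ⟨z, hz, rfl⟩⟩

end ConformalEquiv

/-! ### Restriction maps: images of bounded sets; `Φ_A⁻¹ → 0` at `0` -/

section Maps

variable {A : Set ℂ} {Φ : ConformalEquiv (upperHalfPlaneSet \ A) upperHalfPlaneSet}

/-- **`Φ_A` is bounded on bounded sets** (properness of `Φ_A⁻¹` at `∞`,
`IsRestrictionMap.tendsto_symm_cocompact`). [folklore] -/
theorem IsRestrictionMap.isBounded_image (hA : IsStarHull A) (hΦ : IsRestrictionMap A Φ) {S : Set ℂ}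
    (hS : S ⊆ upperHalfPlaneSet \ A) (hSb : IsBounded S) : IsBounded (Φ '' S) := by
  obtain ⟨R, hR⟩ := hSb.subset_closedBall 0
  have h := hΦ.tendsto_symm_cocompact hA ((isCompact_closedBall (0 : ℂ) R).compl_mem_cocompact)
  rw [mem_map, mem_inf_principal, mem_cocompact] at h
  obtain ⟨C, hC, hCsub⟩ := h
  refine hC.isBounded.subset ?_
  rintro _ ⟨z, hz, rfl⟩
  by_contra hw
  have := hCsub hw (Φ.mapsTo (hS hz))
  rw [mem_preimage, Φ.symm_apply_apply (hS hz)] at this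
  exact this (hR hz)

/-- **`Φ_A⁻¹(w) → 0` as `w → 0` in `ℍ`.** The Schwarz reflection `E = hullExt Φ` is holomorphic
at `0` with `E(0) = 0`, `E'(0) = Φ'_A(0) > 0`, so by the open mapping theorem `E(B(0, ε))` is a
neighbourhood of `0`; a point `w ∈ ℍ` of it is `E(ζ)`, `|ζ| < ε`, and `ζ` lies in `ℍ` (real `ζ`
have real images, `ζ` of the lower half-plane have images there), so that `Φ_A⁻¹(w) = ζ`.
[cite: LawlerSchrammWerner2003Restriction, proof of Lemma 3.5 (p. 12: Φ_A extends by Schwarz reflection to a neighbourhood of 0)] -/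
theorem IsRestrictionMap.tendsto_symm_nhdsWithin_zero (hA : IsStarHull A) (hΦ : IsRestrictionMap A Φ) :
    Tendsto Φ.symm (𝓝[upperHalfPlaneSet] 0) (𝓝 0) := by
  have hB := hA.isBoundedHull
  obtain ⟨d, hd0, -, hd⟩ := IsStarHull.exists_hasRestrictionDeriv_holds hA hΦ
  -- a symmetric disc about `0` off `A`
  obtain ⟨r₀, hr₀, hball⟩ : ∃ r₀ > 0, Disjoint (ball ((0 : ℝ) : ℂ) r₀) A := by
    have h0 : (0 : ℂ) ∈ Aᶜ := hA.zero_notMem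
    obtain ⟨r₀, hr₀, hsub⟩ := Metric.isOpen_iff.1 hB.isClosed.isOpen_compl 0 h0
    refine ⟨r₀, hr₀, ?_⟩
    rw [ofReal_zero]
    exact Set.disjoint_left.2 fun z hz hzA ↦ hsub hz hzA
  have hsymm : ball (0 : ℂ) r₀ ⊆ symmDomain A := by
    have := ball_subset_symmDomain hball
    rwa [ofReal_zero] at this
  -- the reflection is analytic and not locally constant at `0`
  set E : ℂ → ℂ := hullExt Φ with hE
  have hEd : DifferentiableOn ℂ E (symmDomain A) := differentiableOn_hullExt hB hΦ
  have hEa : AnalyticAt ℂ E 0 :=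
    hEd.analyticAt ((isOpen_symmDomain hB.isClosed).mem_nhds hA.zero_mem_symmDomain)
  have hE0 : E 0 = 0 := hullExt_zero hA hΦ
  have hderiv : HasDerivAt E (d : ℂ) 0 := hasDerivAt_hullExt_zero hA hΦ hd
  have hnc : ¬ ∀ᶠ z in 𝓝 (0 : ℂ), E z = E 0 := by
    intro hev
    have h1 : HasDerivAt E 0 0 := by
      refine (hasDerivAt_const (0 : ℂ) (E 0)).congr_of_eventuallyEq ?_
      filter_upwards [hev] with z hz using hz
    have := hderiv.unique h1
    exact hd0.ne' (by exact_mod_cast this)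
  have hmap : 𝓝 (0 : ℂ) ≤ map E (𝓝 0) := by
    rcases hEa.eventually_constant_or_nhds_le_map_nhds with h | h
    · exact absurd h hnc
    · rwa [hE0] at h
  -- conclusion
  rw [Metric.tendsto_nhds]
  intro ε hε
  set ε' : ℝ := min ε r₀ with hε'
  have hε'0 : 0 < ε' := lt_min hε hr₀
  have hN : E '' ball (0 : ℂ) ε' ∈ 𝓝 (0 : ℂ) := hmap (image_mem_map (ball_mem_nhds 0 hε'0))
  filter_upwards [mem_nhdsWithin_of_mem_nhds hN, self_mem_nhdsWithin] with w hw hwH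
  obtain ⟨ζ, hζ, rfl⟩ := hw
  have hζr : ζ ∈ ball (0 : ℂ) r₀ := ball_subset_ball (min_le_right _ _) hζ
  have hζA : ζ ∉ A := Set.disjoint_left.1 hball (by rwa [ofReal_zero])
  have hwH' : 0 < (E ζ).im := hwH
  -- `ζ` lies in the open upper half-plane
  have hζim : 0 < ζ.im := by
    by_contra hle
    rcases (not_lt.1 hle).lt_or_eq with hneg | hzero
    · have := hullExt_im_neg hB hΦ (hsymm hζr) hneg
      linarith
    · have hζreal : ζ = ((ζ.re : ℝ) : ℂ) := Complex.ext (by simp) (by simp [hzero])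
      have hnot : ((ζ.re : ℝ) : ℂ) ∉ A := hζreal ▸ hζA
      have := hullExt_ofReal_im hB hΦ hnot
      rw [← hζreal] at this
      linarith
  have hζdom : ζ ∈ upperHalfPlaneSet \ A := ⟨hζim, hζA⟩
  rw [show E ζ = Φ ζ from hullExt_of_mem_diff hζdom, Φ.symm_apply_apply hζdom, dist_zero_right]
  have : dist ζ 0 < ε' := mem_ball.1 hζ
  rw [dist_zero_right] at this
  exact this.trans_le (min_le_left _ _)

/-- **A real nonzero accumulation point of the image.** If `S ⊆ ℍ ∖ A` is bounded and
accumulates at a point `q ≠ 0` outside `ℍ ∖ A`, then `Φ_A(S)` accumulates at a nonzero real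
point: along `z_n → q` in `S` the bounded sequence `Φ_A(z_n)` (`IsRestrictionMap.isBounded_image`)
has a limit point, which is not in `ℍ` (else `z_n → Φ_A⁻¹(limit) ∈ ℍ ∖ A`), hence real, and
not `0` (else `z_n → 0`, `IsRestrictionMap.tendsto_symm_nhdsWithin_zero`). [folklore] -/
theorem IsRestrictionMap.exists_real_mem_closure_image (hA : IsStarHull A) (hΦ : IsRestrictionMap A Φ)
    {S : Set ℂ} (hS : S ⊆ upperHalfPlaneSet \ A) (hSb : IsBounded S) {q : ℂ} (hq : q ∈ closure S)
    (hqdom : q ∉ upperHalfPlaneSet \ A) (hq0 : q ≠ 0) :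
    ∃ r ∈ closure (Φ '' S), r.im = 0 ∧ r ≠ 0 := by
  obtain ⟨x, hxS, hxq⟩ := mem_closure_iff_seq_limit.1 hq
  have hbd : IsBounded (Φ '' S) := hΦ.isBounded_image hA hS hSb
  obtain ⟨M, hM⟩ := hbd.subset_closedBall 0
  obtain ⟨r, -, φ, hφ, hrφ⟩ := (isCompact_closedBall (0 : ℂ) M).tendsto_subseq
    (x := fun n ↦ Φ (x n)) (fun n ↦ hM ⟨x n, hxS n, rfl⟩)
  have hr : r ∈ closure (Φ '' S) :=
    mem_closure_of_tendsto hrφ (Eventually.of_forall fun n ↦ ⟨x (φ n), hxS _, rfl⟩)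
  have hback : Tendsto (fun n ↦ Φ.symm (Φ (x (φ n)))) atTop (𝓝 q) := by
    have : (fun n ↦ Φ.symm (Φ (x (φ n)))) = x ∘ φ := funext fun n ↦ Φ.symm_apply_apply (hS (hxS _))
    rw [this]
    exact hxq.comp hφ.tendsto_atTop
  refine ⟨r, hr, ?_, ?_⟩
  · have hge : 0 ≤ r.im := by
      have : r ∈ closure upperHalfPlaneSet :=
        closure_mono (by rintro _ ⟨z, hz, rfl⟩; exact Φ.mapsTo (hS hz)) hr
      rw [show upperHalfPlaneSet = {z : ℂ | 0 < z.im} from rfl, Complex.closure_setOf_lt_im] at this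
      exact this
    rcases hge.lt_or_eq with hpos | h0
    · exfalso
      have hrH : r ∈ upperHalfPlaneSet := hpos
      have hcont : ContinuousAt Φ.symm r :=
        (Φ.symm.continuousOn r hrH).continuousAt (isOpen_upperHalfPlaneSet.mem_nhds hrH)
      have h1 : Tendsto (fun n ↦ Φ.symm (Φ (x (φ n)))) atTop (𝓝 (Φ.symm r)) := hcont.tendsto.comp hrφ
      have heq := tendsto_nhds_unique h1 hback
      exact hqdom (heq ▸ Φ.symm_mapsTo hrH)
    · exact h0.symm
  · rintro rfl
    have h0 : Tendsto (fun n ↦ Φ (x (φ n))) atTop (𝓝[upperHalfPlaneSet] 0) :=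
      tendsto_nhdsWithin_iff.2 ⟨hrφ, Eventually.of_forall fun n ↦ Φ.mapsTo (hS (hxS _))⟩
    have h1 := (hΦ.tendsto_symm_nhdsWithin_zero hA).comp h0
    exact hq0 (tendsto_nhds_unique hback h1)

end Maps

/-! ### The image configuration `Φ_A(K) ∈ Ω` -/

namespace RestrictionConfig

/-- **Escaping `ℍ ∖ A` off `cl K`.** For `K ∈ Ω`, closed `A` and a point `z ∈ ℍ ∖ A` off `K`,
there is a bounded connected set `P₀ ∋ z` inside `(ℍ ∖ A) ∖ K` accumulating at a point `q`
outside `ℍ ∖ A` and off `cl K` (so `q ≠ 0`): run a path from `z` to `−i` in the connected open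
set `ℂ ∖ cl K` (Def. 3.1 (2)) until it first meets `A ∪ {im ≤ 0}`.
[cite: LawlerSchrammWerner2003Restriction, Def. 3.1 (2) (p. 10)] -/
theorem exists_isPreconnected_escape (K : RestrictionConfig) {A : Set ℂ} (hAc : IsClosed A)
    {z : ℂ} (hz : z ∈ upperHalfPlaneSet \ A) (hzK : z ∉ (K : Set ℂ)) :
    ∃ P₀ : Set ℂ, IsPreconnected P₀ ∧ z ∈ P₀ ∧ P₀ ⊆ upperHalfPlaneSet \ A ∧
      Disjoint P₀ (K : Set ℂ) ∧ IsBounded P₀ ∧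
        ∃ q ∈ closure P₀, q ∉ upperHalfPlaneSet \ A ∧ q ∉ closure (K : Set ℂ) := by
  have hO : IsOpen (closure (K : Set ℂ))ᶜ := isClosed_closure.isOpen_compl
  have hconn : IsConnected (closure (K : Set ℂ))ᶜ := K.2.2.2.2.2
  have hpc : IsPathConnected (closure (K : Set ℂ))ᶜ := hO.isConnected_iff_isPathConnected.1 hconn
  have hzc : z ∉ closure (K : Set ℂ) := fun h ↦ by
    rcases K.closure_subset h with h' | h'
    · exact hzK h'
    · rw [mem_singleton_iff] at h'
      rw [h'] at hz
      exact absurd hz.1 (by simp [upperHalfPlaneSet])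
  have hIc : (-Complex.I) ∉ closure (K : Set ℂ) := fun h ↦ by
    rcases K.closure_subset h with h' | h'
    · have : (0 : ℝ) < (-Complex.I).im := K.subset_upperHalfPlaneSet h'
      norm_num at this
    · norm_num at h'
  have hj := hpc.joinedIn z hzc (-Complex.I) hIc
  set p := hj.somePath with hp_def
  have hp : ∀ t, p t ∈ (closure (K : Set ℂ))ᶜ := hj.somePath_mem
  set F : Set ℂ := A ∪ {w : ℂ | w.im ≤ 0} with hF
  have hFc : IsClosed F := hAc.union (isClosed_le continuous_im continuous_const)
  set f : ℝ → ℂ := fun t ↦ p.extend t with hf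
  have hfc : Continuous f := p.continuous_extend
  set T : Set ℝ := Icc (0 : ℝ) 1 ∩ f ⁻¹' F with hT
  have hTc : IsClosed T := isClosed_Icc.inter (hFc.preimage hfc)
  have h1T : (1 : ℝ) ∈ T := by
    refine ⟨⟨zero_le_one, le_rfl⟩, ?_⟩
    show p.extend 1 ∈ F
    rw [Path.extend_one]
    right
    simp
  have hTne : T.Nonempty := ⟨1, h1T⟩
  have hTbdd : BddBelow T := ⟨0, fun t ht ↦ ht.1.1⟩
  set t₀ : ℝ := sInf T with ht₀
  have ht₀T : t₀ ∈ T := hTc.csInf_mem hTne hTbdd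
  have ht₀le : ∀ t ∈ T, t₀ ≤ t := fun t ht ↦ csInf_le hTbdd ht
  have hf0 : f 0 = z := p.extend_zero
  have h0t₀ : 0 < t₀ := by
    rcases ht₀T.1.1.eq_or_lt with h | h
    · exfalso
      have hmem : f t₀ ∈ F := ht₀T.2
      rw [← h, hf0] at hmem
      rcases hmem with h' | h'
      · exact hz.2 h'
      · exact (not_lt.2 (show z.im ≤ 0 from h')) hz.1
    · exact h
  have hbefore : ∀ t ∈ Ico (0 : ℝ) t₀, f t ∉ F := fun t ht hft ↦
    absurd (ht₀le t ⟨⟨ht.1, ht.2.le.trans ht₀T.1.2⟩, hft⟩) (not_le.2 ht.2)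
  have hIco : Ico (0 : ℝ) t₀ ⊆ Icc 0 1 := fun t ht ↦ ⟨ht.1, ht.2.le.trans ht₀T.1.2⟩
  refine ⟨f '' Ico 0 t₀, isPreconnected_Ico.image f hfc.continuousOn, ⟨0, ⟨le_rfl, h0t₀⟩, hf0⟩,
    ?_, ?_, ?_, f t₀, ?_, ?_, ?_⟩
  · rintro _ ⟨t, ht, rfl⟩
    have h := hbefore t ht
    simp only [hF, mem_union, mem_setOf_eq, not_or, not_le] at h
    exact ⟨h.2, h.1⟩
  · refine Set.disjoint_left.2 ?_
    rintro _ ⟨t, ht, rfl⟩ hK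
    have : f t ∈ (closure (K : Set ℂ))ᶜ := by
      rw [show f t = p ⟨t, hIco ht⟩ from p.extend_apply (hIco ht)]
      exact hp _
    exact this (subset_closure hK)
  · exact (isCompact_Icc.image hfc).isBounded.subset (image_mono hIco)
  · have : t₀ ∈ closure (Ico (0 : ℝ) t₀) := by
      rw [closure_Ico h0t₀.ne]
      exact ⟨h0t₀.le, le_rfl⟩
    exact image_closure_subset_closure_image hfc ⟨t₀, this, rfl⟩
  · intro hmem
    rcases ht₀T.2 with h | h
    · exact hmem.2 h
    · exact (not_lt.2 (show (f t₀).im ≤ 0 from h)) hmem.1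
  · rw [show f t₀ = p ⟨t₀, ht₀T.1⟩ from p.extend_apply ht₀T.1]
    exact hp _

variable {A : Set ℂ} {Φ : ConformalEquiv (upperHalfPlaneSet \ A) upperHalfPlaneSet}

/-- **The image of a configuration is a configuration** ([LSW] p. 10: "the law of `Φ_A(K)`
conditional on `{K ∩ A = ∅}`" presupposes `Φ_A(K) ∈ Ω`): for `K ∈ Ω` with `K ∩ A = ∅`,
`A ∈ 𝒬*`, and a restriction map `Φ_A`, the set `Φ_A(K)` is relatively closed in `ℍ`, connected,
unbounded, with `cl Φ_A(K) ∩ ℝ = {0}` (`IsRestrictionMap.closure_image_subset`,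
`IsRestrictionMap.not_isBounded_image`, `Φ_A(0) = 0`), and `ℂ ∖ cl Φ_A(K)` is connected: each
point `Φ_A(z)` of `ℍ ∖ Φ_A(K)` lies, together with the lower half-plane, in the connected set
`Φ_A(P₀) ∪ {r} ∪ ({im ≤ 0} ∖ {0})`, `P₀` the escape set of `exists_isPreconnected_escape` and
`r ≠ 0` a real accumulation point of `Φ_A(P₀)` (`IsRestrictionMap.exists_real_mem_closure_image`).
[cite: LawlerSchrammWerner2003Restriction, Def. 3.1 and §3 p. 10 (the law of Φ_A(K))] -/
theorem image_mem_restrictionConfigs (hA : IsStarHull A) (hΦ : IsRestrictionMap A Φ)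
    (K : RestrictionConfig) (hK : Disjoint (K : Set ℂ) A) :
    Φ '' (K : Set ℂ) ∈ restrictionConfigs := by
  have hAc : IsClosed A := hA.isBoundedHull.isClosed
  have hKsub : (K : Set ℂ) ⊆ upperHalfPlaneSet \ A := fun z hz ↦
    ⟨K.subset_upperHalfPlaneSet hz, Set.disjoint_left.1 hK hz⟩
  set K' : Set ℂ := Φ '' (K : Set ℂ) with hK'
  have hK'H : K' ⊆ upperHalfPlaneSet := by
    rintro _ ⟨z, hz, rfl⟩
    exact Φ.mapsTo (hKsub hz)
  have hcl : closure K' ⊆ K' ∪ {0} := hΦ.closure_image_subset hAc hKsub K.closure_subset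
  have h0cl : (0 : ℂ) ∈ closure K' := by
    haveI : (𝓝[(K : Set ℂ)] (0 : ℂ)).NeBot := mem_closure_iff_nhdsWithin_neBot.1 K.zero_mem_closure
    have ht : Tendsto Φ (𝓝[(K : Set ℂ)] 0) (𝓝 0) := hΦ.1.mono_left (nhdsWithin_mono _ hKsub)
    exact mem_closure_of_tendsto ht (eventually_nhdsWithin_of_forall fun z hz ↦ mem_image_of_mem _ hz)
  have hcleq : closure K' = K' ∪ {0} :=
    hcl.antisymm (union_subset subset_closure (singleton_subset_iff.2 h0cl))
  have h0H : (0 : ℂ) ∉ upperHalfPlaneSet := by simp [upperHalfPlaneSet]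
  refine ⟨?_, ?_, ?_, hΦ.not_isBounded_image hKsub K.not_isBounded, ?_⟩
  · -- relatively closed
    refine Subset.antisymm ?_ fun w hw ↦ ⟨subset_closure hw, hK'H hw⟩
    rintro w ⟨hw, hwH⟩
    rcases hcl hw with h | h
    · exact h
    · rw [mem_singleton_iff] at h
      exact absurd hwH (h ▸ h0H)
  · -- connected
    exact K.isConnected.image Φ (Φ.continuousOn.mono hKsub)
  · -- `cl ∩ ℝ = {0}`
    refine Subset.antisymm ?_ ?_
    · rintro w ⟨hw, ⟨x, rfl⟩⟩
      rcases hcl hw with h | h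
      · have : (0 : ℝ) < ((x : ℝ) : ℂ).im := hK'H h
        simp at this
      · exact h
    · rintro w hw
      rw [mem_singleton_iff] at hw
      subst hw
      exact ⟨h0cl, 0, ofReal_zero⟩
  · -- `ℂ ∖ cl Φ(K)` is connected
    rw [hcleq]
    set Low : Set ℂ := {w : ℂ | w.im ≤ 0} \ {0} with hLow
    have hLowc : IsPreconnected Low := by
      refine (convex_halfSpace_im_lt (0 : ℝ)).isPreconnected.subset_closure ?_ ?_
      · intro w hw
        have hw' : w.im < 0 := hw
        refine ⟨hw'.le, fun h0 ↦ ?_⟩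
        rw [mem_singleton_iff] at h0
        rw [h0] at hw'
        simp at hw'
      · rw [Complex.closure_setOf_im_lt]
        exact fun w hw ↦ hw.1
    have hLowsub : Low ⊆ (K' ∪ {0})ᶜ := by
      rintro w ⟨hwim, hw0⟩ (hwK | hw0')
      · exact (not_lt.2 (show w.im ≤ 0 from hwim)) (hK'H hwK)
      · exact hw0 hw0'
    have hIlow : (-Complex.I) ∈ Low := ⟨by simp, by simp⟩
    refine ⟨⟨-Complex.I, hLowsub hIlow⟩, isPreconnected_of_forall (-Complex.I) fun w hw ↦ ?_⟩
    by_cases hwlow : w.im ≤ 0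
    · have hw0 : w ≠ 0 := fun h ↦ hw (Or.inr h)
      exact ⟨Low, hLowsub, hIlow, ⟨hwlow, hw0⟩, hLowc⟩
    · have hwH : w ∈ upperHalfPlaneSet := lt_of_not_ge hwlow
      set z := Φ.symm w with hz_def
      have hz : z ∈ upperHalfPlaneSet \ A := Φ.symm_mapsTo hwH
      have hzw : Φ z = w := Φ.apply_symm_apply hwH
      have hzK : z ∉ (K : Set ℂ) := fun h ↦ hw (Or.inl ⟨z, h, hzw⟩)
      obtain ⟨P₀, hP₀c, hzP₀, hP₀sub, hP₀K, hP₀b, q, hq, hqdom, hqK⟩ :=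
        K.exists_isPreconnected_escape hAc hz hzK
      have hq0 : q ≠ 0 := fun h ↦ hqK (h ▸ K.zero_mem_closure)
      obtain ⟨r, hr, hrim, hr0⟩ := hΦ.exists_real_mem_closure_image hA hP₀sub hP₀b hq hqdom hq0
      have hrLow : r ∈ Low := ⟨le_of_eq hrim, hr0⟩
      refine ⟨(Φ '' P₀ ∪ {r}) ∪ Low, ?_, Or.inr hIlow, Or.inl (Or.inl ⟨z, hzP₀, hzw⟩), ?_⟩
      · refine union_subset (union_subset ?_ (singleton_subset_iff.2 (hLowsub hrLow))) hLowsub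
        rintro _ ⟨v, hv, rfl⟩ (hvK | hv0)
        · obtain ⟨k, hk, hkv⟩ := hvK
          have : k = v := Φ.injOn (hKsub hk) (hP₀sub hv) hkv
          exact Set.disjoint_left.1 hP₀K hv (this ▸ hk)
        · rw [mem_singleton_iff] at hv0
          have : (0 : ℝ) < (Φ v).im := Φ.mapsTo (hP₀sub hv)
          rw [hv0] at this
          simp at this
      · have h1 : IsPreconnected (Φ '' P₀ ∪ {r}) :=
          (hP₀c.image Φ (Φ.continuousOn.mono hP₀sub)).subset_closure subset_union_left
            (union_subset subset_closure (singleton_subset_iff.2 hr))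
        exact h1.union r (Or.inr rfl) hrLow hLowc

/-! ### Avoidance of product hulls through the image -/

/-- **`K ∩ (B · A) = ∅ ⟺ K ∩ A = ∅` and `Φ_A(K) ∩ B = ∅`**, for any map `Θ` on `Ω` realizing
`K ↦ Φ_A(K)` on `{K ∩ A = ∅}`. [cite: LawlerSchrammWerner2003Restriction, §2 p. 8 (Semigroups)] -/
theorem preimage_avoid_inter_avoid_eq (hA : IsStarHull A) {B : Set ℂ} (hB : IsStarHull B)
    {Θ : RestrictionConfig → RestrictionConfig}
    (hΘ : ∀ K : RestrictionConfig, Disjoint (K : Set ℂ) A → ((Θ K : RestrictionConfig) : Set ℂ) = Φ '' (K : Set ℂ)) :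
    Θ ⁻¹' avoid B ∩ avoid A = avoid (hullProduct B A Φ) := by
  have hAc : IsClosed A := hA.isBoundedHull.isClosed
  have hBc : IsClosed B := hB.isBoundedHull.isClosed
  ext K
  rw [mem_avoid_hullProduct_iff hBc hAc (K := K)]
  simp only [mem_inter_iff, mem_preimage, mem_avoid]
  constructor
  · rintro ⟨hΘB, hKA⟩
    refine ⟨hKA, fun z hz hzB ↦ ?_⟩
    have : Φ z ∈ ((Θ K : RestrictionConfig) : Set ℂ) := by
      rw [hΘ K hKA]
      exact ⟨z, hz, rfl⟩
    exact Set.disjoint_left.1 hΘB this hzB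
  · rintro ⟨hKA, h⟩
    refine ⟨?_, hKA⟩
    rw [Set.disjoint_left, hΘ K hKA]
    rintro _ ⟨z, hz, rfl⟩
    exact h z hz

/-- Such a map `Θ`, equal to the identity off `{K ∩ A = ∅}`, is measurable (its preimages of
the generating events are avoidance events up to the measurable set `{K ∩ A ≠ ∅}`). [folklore] -/
theorem measurable_of_image_spec (hA : IsStarHull A) (hΦ : IsRestrictionMap A Φ)
    {Θ : RestrictionConfig → RestrictionConfig}
    (hΘ : ∀ K : RestrictionConfig, Disjoint (K : Set ℂ) A → ((Θ K : RestrictionConfig) : Set ℂ) = Φ '' (K : Set ℂ))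
    (hΘ' : ∀ K : RestrictionConfig, ¬ Disjoint (K : Set ℂ) A → Θ K = K) : Measurable Θ := by
  refine measurable_generateFrom ?_
  rintro _ ⟨B, hB, rfl⟩
  have key : Θ ⁻¹' avoid B = avoid (hullProduct B A Φ) ∪ ((avoid A)ᶜ ∩ avoid B) := by
    rw [← preimage_avoid_inter_avoid_eq hA hB hΘ]
    ext K
    simp only [mem_union, mem_inter_iff, mem_preimage, mem_compl_iff, mem_avoid]
    by_cases hK : Disjoint (K : Set ℂ) A
    · simp [hK]
    · simp [hK, hΘ' K hK]
  rw [key]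
  exact (measurableSet_avoid (hB.hullProduct hA hΦ)).union
    ((measurableSet_avoid hA).compl.inter (measurableSet_avoid hB))

end RestrictionConfig

open RestrictionConfig

/-! ### The restriction property and the zero–one law -/

section ZeroOne

variable {α : ℝ} {P : Measure RestrictionConfig} {A : Set ℂ}
  {Φ : ConformalEquiv (upperHalfPlaneSet \ A) upperHalfPlaneSet}

/-- **`P_α[K ∩ (B · A) = ∅] = P_α[K ∩ A = ∅] · P_α[K ∩ B = ∅]`** ([LSW] proof of Prop. 3.3:
"`F(A · A') = F(A) F(A')`"): the chain rule `Φ'_{B·A}(0) = Φ'_B(0) Φ'_A(0)` and the avoidance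
formula. [cite: LawlerSchrammWerner2003Restriction, Prop. 3.3 proof (p. 11)] -/
theorem IsRestrictionMeasure.measure_avoid_hullProduct (hP : IsRestrictionMeasure α P)
    (hA : IsStarHull A) (hΦ : IsRestrictionMap A Φ) {B : Set ℂ} (hB : IsStarHull B) :
    P (avoid (hullProduct B A Φ)) = P (avoid A) * P (avoid B) := by
  obtain ⟨ΦB, hΦB⟩ := hB.exists_isRestrictionMap
  obtain ⟨dA, hdA0, -, hdA⟩ := IsStarHull.exists_hasRestrictionDeriv_holds hA hΦ
  obtain ⟨dB, hdB0, -, hdB⟩ := IsStarHull.exists_hasRestrictionDeriv_holds hB hΦB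
  have hAc : IsClosed A := hA.isBoundedHull.isClosed
  have hBc : IsClosed B := hB.isBoundedHull.isClosed
  rw [hP.2 (hB.hullProduct hA hΦ) (hΦB.hullProduct hBc hAc hΦ) (hdB.hullProduct hBc hAc hΦ hdA),
    hP.2 hA hΦ hdA, hP.2 hB hΦB hdB, ← ENNReal.ofReal_mul (Real.rpow_nonneg hdA0.le _),
    ← Real.mul_rpow hdA0.le hdB0.le, mul_comm dB dA]

/-- **The restriction property of `P_α`** ([LSW] §3 p. 10: "for all `A ∈ 𝒜`, the law of
`Φ_A(K)` conditional on `{K ∩ A = ∅}` is equal to `P`"; Prop. 3.3 (3) ⇒ (2)): for a map `Θ`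
on `Ω` realizing `K ↦ Φ_A(K)` on `{K ∩ A = ∅}` and every measurable `F`,
`P_α[K ∩ A = ∅, Θ(K) ∈ F] = P_α[K ∩ A = ∅] · P_α(F)` — the finite measures
`F ↦ P_α[K ∩ A = ∅, Θ(K) ∈ F]` and `P_α[K ∩ A = ∅] · P_α` agree on the avoidance events
(`measure_avoid_hullProduct`) and these form a generating π-system (Lemma 3.2).
[cite: LawlerSchrammWerner2003Restriction, §3 p. 10 and Prop. 3.3 (pp. 10–11)] -/
theorem IsRestrictionMeasure.measure_avoid_inter_preimage_eq (hP : IsRestrictionMeasure α P)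
    (hA : IsStarHull A) (hΦ : IsRestrictionMap A Φ) {Θ : RestrictionConfig → RestrictionConfig}
    (hΘ : ∀ K : RestrictionConfig, Disjoint (K : Set ℂ) A → ((Θ K : RestrictionConfig) : Set ℂ) = Φ '' (K : Set ℂ))
    (hΘ' : ∀ K : RestrictionConfig, ¬ Disjoint (K : Set ℂ) A → Θ K = K)
    {F : Set RestrictionConfig} (hF : MeasurableSet F) :
    P (avoid A ∩ Θ ⁻¹' F) = P (avoid A) * P F := by
  haveI := hP.isProbabilityMeasure
  have hΘm : Measurable Θ := measurable_of_image_spec hA hΦ hΘ hΘ'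
  have hmA : MeasurableSet (avoid A) := measurableSet_avoid hA
  set ν : Measure RestrictionConfig := (P.restrict (avoid A)).map Θ with hν
  have hνapp : ∀ {S : Set RestrictionConfig}, MeasurableSet S → ν S = P (avoid A ∩ Θ ⁻¹' S) := by
    intro S hS
    rw [hν, Measure.map_apply hΘm hS, Measure.restrict_apply (hΘm hS), inter_comm]
  haveI : IsFiniteMeasure ν := ⟨by rw [hνapp MeasurableSet.univ]; exact measure_lt_top P _⟩
  haveI : IsFiniteMeasure (P (avoid A) • P) :=
    ⟨by rw [Measure.smul_apply, smul_eq_mul, measure_univ, mul_one]; exact measure_lt_top P _⟩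
  have key : ν = P (avoid A) • P := by
    refine ext_of_generate_finite {S | ∃ A, IsStarHull A ∧ S = avoid A} rfl isPiSystem_avoid_holds ?_ ?_
    · rintro _ ⟨B, hB, rfl⟩
      rw [hνapp (measurableSet_avoid hB), Measure.smul_apply, smul_eq_mul, inter_comm,
        preimage_avoid_inter_avoid_eq hA hB hΘ, hP.measure_avoid_hullProduct hA hΦ hB]
    · rw [hνapp MeasurableSet.univ, Measure.smul_apply, smul_eq_mul, measure_univ, mul_one,
        preimage_univ, inter_univ]
  rw [← hνapp hF, key, Measure.smul_apply, smul_eq_mul]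

/-- **ZERO–ONE LAW FOR RESTRICTION MEASURES.** Let `P` be a two-sided restriction measure (any
exponent) and `E ⊆ Ω` a measurable event invariant under the maps `Φ_A`: for every `A ∈ 𝒬*`,
every restriction map `Φ_A` and every `K ∈ Ω` with `K ∩ A = ∅`, `K ∈ E ⟺ Φ_A(K) ∈ E`
(stated for any `K' ∈ Ω` with `K' = Φ_A(K)` as sets; such `K'` exists,
`RestrictionConfig.image_mem_restrictionConfigs`). Then `P(E) ∈ {0, 1}`. Proof: by the
restriction property (`measure_avoid_inter_preimage_eq`) and invariance,
`P(E ∩ {K ∩ A = ∅}) = P(E) · P{K ∩ A = ∅}` for all `A ∈ 𝒬*`; so the finite measures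
`P(· ∩ E)` and `P(E) · P` agree on the generating π-system and on `Ω` (Lemma 3.2), whence
`P(E) = P(E ∩ E) = P(E)²`. [cite: LawlerSchrammWerner2003Restriction, §3 p. 10 (restriction property) with Lemma 3.2 and Prop. 3.3 (pp. 10–11)] -/
theorem IsRestrictionMeasure.measure_eq_zero_or_one_of_invariant (hP : IsRestrictionMeasure α P)
    {E : Set RestrictionConfig} (hE : MeasurableSet E)
    (hinv : ∀ {A : Set ℂ}, IsStarHull A →
      ∀ {Φ : ConformalEquiv (upperHalfPlaneSet \ A) upperHalfPlaneSet}, IsRestrictionMap A Φ →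
        ∀ K K' : RestrictionConfig, Disjoint (K : Set ℂ) A → (K' : Set ℂ) = Φ '' (K : Set ℂ) →
          (K ∈ E ↔ K' ∈ E)) :
    P E = 0 ∨ P E = 1 := by
  haveI := hP.isProbabilityMeasure
  classical
  -- Step 1: `P (avoid A ∩ E) = P (avoid A) * P E`
  have hfac : ∀ A : Set ℂ, IsStarHull A → P (avoid A ∩ E) = P (avoid A) * P E := by
    intro A hA
    obtain ⟨Φ, hΦ⟩ := hA.exists_isRestrictionMap
    let Θ : RestrictionConfig → RestrictionConfig := fun K ↦
      if h : Disjoint (K : Set ℂ) A then ⟨Φ '' (K : Set ℂ), image_mem_restrictionConfigs hA hΦ K h⟩ else K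
    have hΘ : ∀ K : RestrictionConfig, Disjoint (K : Set ℂ) A →
        ((Θ K : RestrictionConfig) : Set ℂ) = Φ '' (K : Set ℂ) := fun K h ↦ by
      simp only [Θ, dif_pos h]
    have hΘ' : ∀ K : RestrictionConfig, ¬ Disjoint (K : Set ℂ) A → Θ K = K := fun K h ↦ by
      simp only [Θ, dif_neg h]
    have hpre : avoid A ∩ Θ ⁻¹' E = avoid A ∩ E := by
      ext K
      simp only [mem_inter_iff, mem_preimage, mem_avoid]
      constructor
      · rintro ⟨hKA, hΘE⟩
        exact ⟨hKA, (hinv hA hΦ K (Θ K) hKA (hΘ K hKA)).2 hΘE⟩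
      · rintro ⟨hKA, hKE⟩
        exact ⟨hKA, (hinv hA hΦ K (Θ K) hKA (hΘ K hKA)).1 hKE⟩
    rw [← hpre]
    exact hP.measure_avoid_inter_preimage_eq hA hΦ hΘ hΘ' hE
  -- Step 2: `P E = P E * P E`
  have hEE : P E = P E * P E := by
    haveI : IsFiniteMeasure (P E • P) :=
      ⟨by rw [Measure.smul_apply, smul_eq_mul, measure_univ, mul_one]; exact measure_lt_top P E⟩
    have key : P.restrict E = P E • P := by
      refine ext_of_generate_finite {S | ∃ A, IsStarHull A ∧ S = avoid A} rfl isPiSystem_avoid_holds ?_ ?_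
      · rintro _ ⟨A, hA, rfl⟩
        rw [Measure.restrict_apply (measurableSet_avoid hA), Measure.smul_apply, smul_eq_mul,
          hfac A hA, mul_comm]
      · rw [Measure.restrict_apply MeasurableSet.univ, univ_inter, Measure.smul_apply, smul_eq_mul,
          measure_univ, mul_one]
    have h := congrArg (fun μ : Measure RestrictionConfig ↦ μ E) key
    simp only [Measure.restrict_apply hE, inter_self, Measure.smul_apply, smul_eq_mul] at h
    exact h
  -- Step 3: `x = x²`, `x ≤ 1`
  by_cases h0 : P E = 0
  · exact Or.inl h0
  · right
    have h1 : P E * 1 = P E * P E := by rw [mul_one]; exact hEE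
    exact ((ENNReal.mul_right_inj h0 (measure_ne_top P E)).1 h1).symm

/-- **The event "`K` has an interior point" is `Φ_A`-invariant, hence trivial under every
`P_α`**: `Φ_A` is a homeomorphism of the open set `ℍ ∖ A ⊇ K` onto `ℍ`
(`ConformalEquiv.interior_image_nonempty_iff`).
[cite: LawlerSchrammWerner2003Restriction, §3 p. 10 (restriction property) with Lemma 3.2] -/
theorem IsRestrictionMeasure.measure_interior_nonempty_eq_zero_or_one (hP : IsRestrictionMeasure α P) :
    P {K : RestrictionConfig | (interior (K : Set ℂ)).Nonempty} = 0 ∨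
      P {K : RestrictionConfig | (interior (K : Set ℂ)).Nonempty} = 1 := by
  refine hP.measure_eq_zero_or_one_of_invariant measurableSet_interior_nonempty ?_
  intro A hA Φ _ K K' hKA hK'
  have hKsub : (K : Set ℂ) ⊆ upperHalfPlaneSet \ A := fun z hz ↦
    ⟨K.subset_upperHalfPlaneSet hz, Set.disjoint_left.1 hKA hz⟩
  show (interior (K : Set ℂ)).Nonempty ↔ (interior (K' : Set ℂ)).Nonempty
  rw [hK']
  exact (Φ.interior_image_nonempty_iff (isOpen_upperHalfPlaneSet.sdiff hA.isBoundedHull.isClosed)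
    isOpen_upperHalfPlaneSet hKsub).symm

/-- **From positive probability to almost surely**: if `P_α{int K ≠ ∅} > 0` then `P_α`-almost
every `K` has an interior point. [cite: LawlerSchrammWerner2003Restriction, §3 p. 10 (restriction property) with Lemma 3.2] -/
theorem IsRestrictionMeasure.ae_interior_nonempty_of_measure_ne_zero (hP : IsRestrictionMeasure α P)
    (hne : P {K : RestrictionConfig | (interior (K : Set ℂ)).Nonempty} ≠ 0) :
    ∀ᵐ K : RestrictionConfig ∂P, (interior (K : Set ℂ)).Nonempty := by
  haveI := hP.isProbabilityMeasure
  rcases hP.measure_interior_nonempty_eq_zero_or_one with h | h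
  · exact absurd h hne
  · rw [ae_iff]
    exact (prob_compl_eq_zero_iff measurableSet_interior_nonempty).2 h

/-- Dually: if `P_α{int K = ∅} > 0` then `P_α`-almost every `K` has empty interior. [cite: LawlerSchrammWerner2003Restriction, §3 p. 10 (restriction property) with Lemma 3.2] -/
theorem IsRestrictionMeasure.ae_interior_eq_empty_of_measure_ne_one (hP : IsRestrictionMeasure α P)
    (hne : P {K : RestrictionConfig | (interior (K : Set ℂ)).Nonempty} ≠ 1) :
    ∀ᵐ K : RestrictionConfig ∂P, interior (K : Set ℂ) = ∅ := by
  rcases hP.measure_interior_nonempty_eq_zero_or_one with h | h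
  · rw [ae_iff]
    refine measure_mono_null (fun K hK ↦ ?_) h
    exact nonempty_iff_ne_empty.2 hK
  · exact absurd h hne

end ZeroOne

end Literature.Probability.RandomPlanarGeometry

end
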